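import Mathlib.Analysis.SpecialFunctions.Pow.Real
import Mathlib.Analysis.Calculus.Deriv.MeanValue
import Summits.NavierStokesRegularity.FluidComputer.CrossingLadder
import HarnessLib

/-!
# Fluid computer — the DEFICIT-DELAY family of the Reynolds ladder (idea-2's P99 "palinstrophy-exposure
# clock" written as a law; pub-fluidc-lit gen 41)

HONEST FRAMING (cell `pub-fluidc`, verbatim): *low prior, high value-of-information experiment on Tao's
machine paradigm; NOT a claim that NS blows up.*  Theorem side of the cell; pure real bookkeeping, 0 sorry,
no definition, no named fact (D-0026); no PDE object is used.

WHAT IS TYPED.  idea-2's pre-registration P99 (cell STATUS l.4248; audited by the literature seat in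
LITERATURE.md §A22.26) reads the enstrophy of ONE field run at viscosities `ν₀/ρ` as
`Z_ρ(t) = Z_E(t)·(1 − δ_ρ(t))` with `Z_E` the (Galerkin–)Euler envelope, and registers the measured
Re-SIMILARITY `δ_{ρ_b}(t) = δ_{ρ_a}(t − τ·ln(ρ_b/ρ_a))` (one survival curve, DELAYED by `τ` per unit
`ln ρ`; `τ` = the e-fold of the Euler palinstrophy exposure, 0.385 on the cell's field), inferring that "the
`√νZ` crossing of a pair of fixed ratio inherits `dt_x/d ln ρ̄ = τ`".  Here the law is written out as the
family `Z_ρ(t) = Z_E(t) · F(t − τ·log ρ)` (`F` = survival factor, no property of `F` or `Z_E` assumed beyond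
non-vanishing where stated) with `B_ρ(t) = √(ν₀/ρ) · Z_ρ(t)` spelled out in every statement, and the
inference becomes an identity of the family:

* `survival_shift` — rung `κρ` at time `t + τ log κ` has the survival factor of rung `ρ` at time `t`;
* `cross_iff_ratio` — the crossing condition `B_a(t) = B_b(t)` does not see `Z_E`: it reads
  `F(t − τ log ρ_a)·√ρ_b = F(t − τ log ρ_b)·√ρ_a`;
* `cross_shift_iff` — **the LOG-FAN law**: `(κρ_a, κρ_b)` cross at `t + τ log κ` iff `(ρ_a, ρ_b)` cross at
  `t`; with a unique crossing, `t_x(κρ_a, κρ_b) = t_x(ρ_a, ρ_b) + τ log κ` (`crossing_time_shift`): same-ratio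
  pairs recede by EXACTLY `τ` per unit `ln ρ̄` — so a measured `τ_x ≠ τ` measures the departure from the
  similarity, nothing else;
* `level_shift` — the deficit level-crossing times shift the same way (the measured object of P99 (iii));
* `crossValue_shift` / `crossValue_lt_iff` — the `B`-value carried to the shifted pair is the old one times
  `Z_E(t + τ log κ)/(√κ · Z_E(t))`, so the crossing LEVEL rises along the ladder (P98 K1-(iii)) iff the Euler
  envelope grows by more than `√κ` over the delay `τ log κ`.

* `exponent_eq_slope` / `exponent_eq_tau_mul_deriv` / `cross_iff_deriv_eq` (§2, appended the same day) — in the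
  exponent currency of `CrossingLadder` §2 with survival factor `F = exp ∘ (−φ)` (`φ` = the log-deficit): the pairwise
  exponent `a = log(Z_b/Z_a)/log(ρ_b/ρ_a)` is `τ` times the difference quotient of `φ` between the two delayed clocks,
  hence (mean value theorem) `a = τ·φ'(ξ)` at an intermediate delayed time, and the pair crosses exactly when that
  log-deficit RATE equals `1/(2τ)` — one survival curve and one number `τ` fix every crossing of the family.

Companions: `EnstrophyCrossing` §3 (amplitude-exponent family), `CrossingLadder` (model-free sandwich),
`CrossingDelay` (rigid delay of the whole `B`-curve, which the cell's data exclude; the present family delays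
only the survival factor under a common envelope, which the data support to `δ ≈ 0.4`).
-/

noncomputable section

namespace Summit.NavierStokesRegularity.FluidComputer.DeficitDelay

open Real

variable {ZE F : ℝ → ℝ} {ν₀ τ ρ ρa ρb κ t s : ℝ}

/-! The family, written out (no definition is introduced):
`Z_ρ(t) = ZE t * F (t - τ * log ρ)`, `B_ρ(t) = sqrt (ν₀ / ρ) * (ZE t * F (t - τ * log ρ))`,
deficit `δ_ρ(t) = 1 - F (t - τ * log ρ)`. -/

/-- **Survival factors translate along the ladder**: rung `κρ` at time `t + τ log κ` carries the survival
factor of rung `ρ` at time `t` (`κ, ρ > 0`). -/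
theorem survival_shift (hκ : 0 < κ) (hρ : 0 < ρ) (t : ℝ) :
    F (t + τ * log κ - τ * log (κ * ρ)) = F (t - τ * log ρ) := by
  rw [log_mul hκ.ne' hρ.ne']
  ring_nf

/-- The deficit's level-crossing times shift by `τ log κ` (P99 (iii)'s measured object):
`δ_{κρ}(t + τ log κ) = δ_ρ(t)`. -/
theorem level_shift (hκ : 0 < κ) (hρ : 0 < ρ) (t : ℝ) :
    1 - F (t + τ * log κ - τ * log (κ * ρ)) = 1 - F (t - τ * log ρ) := by
  rw [survival_shift (F := F) (τ := τ) hκ hρ t]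

/-- **The crossing condition does not see the Euler envelope.**  For `ν₀ > 0`, rungs `ρ_a, ρ_b > 0` and
`Z_E(t) ≠ 0`: `B_a(t) = B_b(t)` iff `F(t − τ log ρ_a)·√ρ_b = F(t − τ log ρ_b)·√ρ_a`. -/
theorem cross_iff_ratio (hν : 0 < ν₀) (hρa : 0 < ρa) (hρb : 0 < ρb) (hZ : ZE t ≠ 0) :
    sqrt (ν₀ / ρa) * (ZE t * F (t - τ * log ρa)) = sqrt (ν₀ / ρb) * (ZE t * F (t - τ * log ρb))
      ↔ F (t - τ * log ρa) * sqrt ρb = F (t - τ * log ρb) * sqrt ρa := by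
  have hc : sqrt ν₀ * ZE t ≠ 0 := mul_ne_zero (sqrt_pos.2 hν).ne' hZ
  have ha : sqrt ρa ≠ 0 := (sqrt_pos.2 hρa).ne'
  have hb : sqrt ρb ≠ 0 := (sqrt_pos.2 hρb).ne'
  rw [sqrt_div' ν₀ hρa.le, sqrt_div' ν₀ hρb.le,
    show sqrt ν₀ / sqrt ρa * (ZE t * F (t - τ * log ρa))
        = (sqrt ν₀ * ZE t) * (F (t - τ * log ρa) / sqrt ρa) by ring,
    show sqrt ν₀ / sqrt ρb * (ZE t * F (t - τ * log ρb))
        = (sqrt ν₀ * ZE t) * (F (t - τ * log ρb) / sqrt ρb) by ring,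
    mul_right_inj' hc, div_eq_div_iff ha hb]

/-- **The LOG-FAN law.**  For `κ > 0` (and `Z_E` non-zero at the two instants): the scaled pair
`(κρ_a, κρ_b)` crosses at `t + τ log κ` iff the pair `(ρ_a, ρ_b)` crosses at `t`. -/
theorem cross_shift_iff (hν : 0 < ν₀) (hρa : 0 < ρa) (hρb : 0 < ρb) (hκ : 0 < κ) (hZ : ZE t ≠ 0)
    (hZ' : ZE (t + τ * log κ) ≠ 0) :
    sqrt (ν₀ / (κ * ρa)) * (ZE (t + τ * log κ) * F (t + τ * log κ - τ * log (κ * ρa)))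
        = sqrt (ν₀ / (κ * ρb)) * (ZE (t + τ * log κ) * F (t + τ * log κ - τ * log (κ * ρb)))
      ↔ sqrt (ν₀ / ρa) * (ZE t * F (t - τ * log ρa)) = sqrt (ν₀ / ρb) * (ZE t * F (t - τ * log ρb)) := by
  have hsκ : 0 < sqrt κ := sqrt_pos.2 hκ
  rw [cross_iff_ratio hν (mul_pos hκ hρa) (mul_pos hκ hρb) hZ', cross_iff_ratio hν hρa hρb hZ,
    survival_shift (F := F) (τ := τ) hκ hρa t, survival_shift (F := F) (τ := τ) hκ hρb t,
    sqrt_mul hκ.le ρb, sqrt_mul hκ.le ρa,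
    show F (t - τ * log ρa) * (sqrt κ * sqrt ρb) = sqrt κ * (F (t - τ * log ρa) * sqrt ρb) by ring,
    show F (t - τ * log ρb) * (sqrt κ * sqrt ρa) = sqrt κ * (F (t - τ * log ρb) * sqrt ρa) by ring,
    mul_right_inj' hsκ.ne']

/-- The same law read at the scaled pair's own clock: `(κρ_a, κρ_b)` cross at `s` iff `(ρ_a, ρ_b)` cross at
`s − τ log κ`. -/
theorem cross_shift_iff' (hν : 0 < ν₀) (hρa : 0 < ρa) (hρb : 0 < ρb) (hκ : 0 < κ)
    (hZ : ZE (s - τ * log κ) ≠ 0) (hZ' : ZE s ≠ 0) :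
    sqrt (ν₀ / (κ * ρa)) * (ZE s * F (s - τ * log (κ * ρa)))
        = sqrt (ν₀ / (κ * ρb)) * (ZE s * F (s - τ * log (κ * ρb)))
      ↔ sqrt (ν₀ / ρa) * (ZE (s - τ * log κ) * F (s - τ * log κ - τ * log ρa))
        = sqrt (ν₀ / ρb) * (ZE (s - τ * log κ) * F (s - τ * log κ - τ * log ρb)) := by
  have h := cross_shift_iff (F := F) (t := s - τ * log κ) hν hρa hρb hκ hZ
    (by rwa [sub_add_cancel])
  simp only [sub_add_cancel] at h
  exact h

/-- **Crossing times shift by exactly `τ log κ`.**  If the pair `(ρ_a, ρ_b)` crosses exactly at `t_x`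
(and nowhere else) and `Z_E` never vanishes, then the pair `(κρ_a, κρ_b)` crosses exactly at
`t_x + τ log κ` (and nowhere else): `dt_x / d ln ρ̄ = τ` at fixed ratio is an identity of the family. -/
theorem crossing_time_shift {tx : ℝ} (hν : 0 < ν₀) (hρa : 0 < ρa) (hρb : 0 < ρb) (hκ : 0 < κ)
    (hZ : ∀ t, ZE t ≠ 0)
    (huniq : ∀ t, sqrt (ν₀ / ρa) * (ZE t * F (t - τ * log ρa))
        = sqrt (ν₀ / ρb) * (ZE t * F (t - τ * log ρb)) ↔ t = tx) (s : ℝ) :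
    sqrt (ν₀ / (κ * ρa)) * (ZE s * F (s - τ * log (κ * ρa)))
        = sqrt (ν₀ / (κ * ρb)) * (ZE s * F (s - τ * log (κ * ρb))) ↔ s = tx + τ * log κ := by
  rw [cross_shift_iff' hν hρa hρb hκ (hZ _) (hZ _), huniq, sub_eq_iff_eq_add]

/-- **The `B`-value carried to the shifted pair.**  Rung `κρ` at time `t + τ log κ` reads
`Z_E(t + τ log κ)/(√κ · Z_E(t))` times rung `ρ`'s `B`-value at `t` (`κ, ρ > 0`, `Z_E(t) ≠ 0`). -/
theorem crossValue_shift (hκ : 0 < κ) (hρ : 0 < ρ) (hZ : ZE t ≠ 0) :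
    sqrt (ν₀ / (κ * ρ)) * (ZE (t + τ * log κ) * F (t + τ * log κ - τ * log (κ * ρ)))
      = ZE (t + τ * log κ) / (sqrt κ * ZE t) * (sqrt (ν₀ / ρ) * (ZE t * F (t - τ * log ρ))) := by
  have hsκ : sqrt κ ≠ 0 := (sqrt_pos.2 hκ).ne'
  rw [survival_shift (F := F) (τ := τ) hκ hρ t, sqrt_div' ν₀ (mul_pos hκ hρ).le, sqrt_div' ν₀ hρ.le, sqrt_mul hκ.le ρ]
  field_simp

/-- **Crossing LEVELS rise along the ladder iff the Euler envelope outgrows `√κ` over the delay.**  With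
rung `ρ`'s `B`-value at `t` positive and `Z_E(t) > 0`, `κ > 0`: the shifted rung's value at `t + τ log κ`
exceeds it iff `√κ · Z_E(t) < Z_E(t + τ log κ)`.  (K1-(iii) "the crossing value rises along the ladder" in
this family = "`Z_E` e-folds faster than `2τ` per unit `ln κ` worth of delay".) -/
theorem crossValue_lt_iff (hκ : 0 < κ) (hρ : 0 < ρ) (hZ : 0 < ZE t)
    (hB : 0 < sqrt (ν₀ / ρ) * (ZE t * F (t - τ * log ρ))) :
    sqrt (ν₀ / ρ) * (ZE t * F (t - τ * log ρ))
        < sqrt (ν₀ / (κ * ρ)) * (ZE (t + τ * log κ) * F (t + τ * log κ - τ * log (κ * ρ)))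
      ↔ sqrt κ * ZE t < ZE (t + τ * log κ) := by
  have hden : 0 < sqrt κ * ZE t := mul_pos (sqrt_pos.2 hκ) hZ
  rw [crossValue_shift hκ hρ hZ.ne', lt_mul_iff_one_lt_left hB, one_lt_div hden]

/-! ## §2 Exponent currency: `a = τ · (log-deficit rate)` and the crossing criterion `φ' = 1/(2τ)` -/

section Exponent

variable {φ : ℝ → ℝ}

/-- With survival factor `F = exp ∘ (−φ)`, the enstrophy ratio of two rungs does not see the envelope:
`Z_b(t)/Z_a(t) = exp(φ(t − τ log ρ_a) − φ(t − τ log ρ_b))` (`Z_E(t) ≠ 0`). -/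
theorem ratio_eq_exp (hZ : ZE t ≠ 0) :
    ZE t * exp (-φ (t - τ * log ρb)) / (ZE t * exp (-φ (t - τ * log ρa)))
      = exp (φ (t - τ * log ρa) - φ (t - τ * log ρb)) := by
  rw [mul_div_mul_left _ _ hZ, ← exp_sub]
  ring_nf

/-- **The pairwise exponent is a difference quotient of the log-deficit.**  For `0 < ρ_a`, `0 < ρ_b` and
`Z_E(t) ≠ 0`: `log(Z_b/Z_a)/log(ρ_b/ρ_a) = (φ(s_a) − φ(s_b))/(log ρ_b − log ρ_a)` with the delayed clocks
`s_a = t − τ log ρ_a`, `s_b = t − τ log ρ_b`. -/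
theorem exponent_eq_slope (hρa : 0 < ρa) (hρb : 0 < ρb) (hZ : ZE t ≠ 0) :
    log (ZE t * exp (-φ (t - τ * log ρb)) / (ZE t * exp (-φ (t - τ * log ρa)))) / log (ρb / ρa)
      = (φ (t - τ * log ρa) - φ (t - τ * log ρb)) / (log ρb - log ρa) := by
  rw [ratio_eq_exp hZ, log_exp, log_div hρb.ne' hρa.ne']

/-- The two delayed clocks differ by `τ` times the log-ratio: `s_a − s_b = τ (log ρ_b − log ρ_a)`. -/
theorem clock_gap (t τ ρa ρb : ℝ) :
    (t - τ * log ρa) - (t - τ * log ρb) = τ * (log ρb - log ρa) := by ring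

/-- Hence, for `τ ≠ 0` and `ρ_a ≠ ρ_b` (both positive): the exponent is `τ` times the slope of `φ` between the two
delayed clocks, `a = τ · (φ(s_a) − φ(s_b))/(s_a − s_b)`. -/
theorem exponent_eq_tau_mul_slope (hρa : 0 < ρa) (hρb : 0 < ρb) (hne : ρa ≠ ρb) (hτ : τ ≠ 0)
    (hZ : ZE t ≠ 0) :
    log (ZE t * exp (-φ (t - τ * log ρb)) / (ZE t * exp (-φ (t - τ * log ρa)))) / log (ρb / ρa)
      = τ * ((φ (t - τ * log ρa) - φ (t - τ * log ρb))
          / ((t - τ * log ρa) - (t - τ * log ρb))) := by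
  have hlog : log ρb - log ρa ≠ 0 := by
    intro h
    exact hne (log_injOn_pos (Set.mem_Ioi.2 hρa) (Set.mem_Ioi.2 hρb) (sub_eq_zero.1 h).symm)
  rw [exponent_eq_slope hρa hρb hZ, clock_gap, mul_comm τ (log ρb - log ρa), ← div_div,
    mul_div_assoc', mul_div_cancel_left₀ _ hτ]

/-- **Mean value form.**  If moreover `φ` is differentiable and `ρ_a < ρ_b`, `0 < τ`: there is an intermediate delayed
time `ξ ∈ (s_b, s_a)` with `a = τ · φ'(ξ)` — the pairwise exponent is `τ` times the log-deficit RATE read at a clock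
between the two rungs' clocks. -/
theorem exponent_eq_tau_mul_deriv (hρa : 0 < ρa) (hab : ρa < ρb) (hτ : 0 < τ) (hZ : ZE t ≠ 0)
    (hφ : Differentiable ℝ φ) :
    ∃ ξ ∈ Set.Ioo (t - τ * log ρb) (t - τ * log ρa),
      log (ZE t * exp (-φ (t - τ * log ρb)) / (ZE t * exp (-φ (t - τ * log ρa)))) / log (ρb / ρa)
        = τ * deriv φ ξ := by
  have hρb : 0 < ρb := hρa.trans hab
  have hlt : t - τ * log ρb < t - τ * log ρa := by
    have := mul_lt_mul_of_pos_left ((log_lt_log_iff hρa hρb).2 hab) hτ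
    linarith
  obtain ⟨ξ, hξ, hd⟩ := exists_deriv_eq_slope φ hlt hφ.continuous.continuousOn
    (hφ.differentiableOn)
  refine ⟨ξ, hξ, ?_⟩
  rw [exponent_eq_tau_mul_slope hρa hρb hab.ne hτ.ne' hZ, hd]

/-- **Crossing criterion in rate form.**  Under the same hypotheses, with `ν₀ > 0` and `Z_E(t) > 0`: the pair
crosses at `t` (`B_a(t) = B_b(t)`) iff `τ · (φ(s_a) − φ(s_b))/(s_a − s_b) = 1/2`, i.e. iff the mean log-deficit rate
between the two delayed clocks is `1/(2τ)` (via `CrossingLadder.sqrt_mul_eq_iff_exponent`). -/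
theorem cross_iff_slope_eq_half (hν : 0 < ν₀) (hρa : 0 < ρa) (hab : ρa < ρb) (hτ : 0 < τ) (hZ : 0 < ZE t) :
    sqrt (ν₀ / ρa) * (ZE t * exp (-φ (t - τ * log ρa)))
        = sqrt (ν₀ / ρb) * (ZE t * exp (-φ (t - τ * log ρb)))
      ↔ τ * ((φ (t - τ * log ρa) - φ (t - τ * log ρb)) / ((t - τ * log ρa) - (t - τ * log ρb))) = 1 / 2 := by
  have hρb : 0 < ρb := hρa.trans hab
  have hνb : 0 < ν₀ / ρb := div_pos hν hρb
  have hνba : ν₀ / ρb < ν₀ / ρa := div_lt_div_of_pos_left hν hρa hab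
  have hq : ν₀ / ρa / (ν₀ / ρb) = ρb / ρa := by
    rw [div_div_div_comm, div_self hν.ne', one_div_div]
  rw [CrossingLadder.sqrt_mul_eq_iff_exponent hνb hνba (mul_pos hZ (exp_pos _)) (mul_pos hZ (exp_pos _)), hq,
    exponent_eq_tau_mul_slope hρa hρb hab.ne hτ.ne' hZ.ne']

/-- **At a crossing, the log-deficit rate `1/(2τ)` is attained between the two clocks.**  If the pair crosses at
`t` (hypotheses as in `cross_iff_slope_eq_half`, `φ` differentiable), then `τ · φ'(ξ) = 1/2` for some intermediate
delayed time `ξ ∈ (s_b, s_a)` (mean value theorem; the converse is not claimed — `ξ` depends on `t`). -/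
theorem cross_imp_exists_deriv (hν : 0 < ν₀) (hρa : 0 < ρa) (hab : ρa < ρb) (hτ : 0 < τ) (hZ : 0 < ZE t)
    (hφ : Differentiable ℝ φ)
    (hx : sqrt (ν₀ / ρa) * (ZE t * exp (-φ (t - τ * log ρa)))
        = sqrt (ν₀ / ρb) * (ZE t * exp (-φ (t - τ * log ρb)))) :
    ∃ ξ ∈ Set.Ioo (t - τ * log ρb) (t - τ * log ρa), τ * deriv φ ξ = 1 / 2 := by
  obtain ⟨ξ, hξ, hd⟩ := exponent_eq_tau_mul_deriv (φ := φ) hρa hab hτ hZ.ne' hφ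
  refine ⟨ξ, hξ, ?_⟩
  rw [← hd, exponent_eq_tau_mul_slope hρa (hρa.trans hab) hab.ne hτ.ne' hZ.ne']
  exact (cross_iff_slope_eq_half hν hρa hab hτ hZ).1 hx

end Exponent

end Summit.NavierStokesRegularity.FluidComputer.DeficitDelay

end
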